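import Summits.AtomisticToContinuum.Crystallization.Theses.FluxTubeKepler
import Summits.AtomisticToContinuum.Crystallization.Theorems.HullMinimalityLayeredWindowsNecessity
import Summits.AtomisticToContinuum.Crystallization.Theorems.PhononSlackCertificatesHullBridgeNonLayeredFraction
import Summits.AtomisticToContinuum.Crystallization.Theorems.FluxTubeKeplerFluxCellKeplerNecessity

/-!
# `FluxCellKepler` (stmt-AtomisticToContinuum-15221), line `Sketch` — the τ-free defect pricing gives
# the coercive two-shell gap at separations `δ ≥ 1/3`

Partial converse of `FluxCellKeplerSketchGaps.stub_defectPricedExcess_of_gaps`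
(`stub_defectPricedExcess ⇐ CoerciveTwoShellGap ∧ NearFieldConvexity`): the registered stub
`stub_defectPricedExcess` of the line IMPLIES the instances `δ ≥ 1/3` of
`PhononSlackCertificates.CoerciveTwoShellGap` (item stmt-AtomisticToContinuum-13956), with
`g(δ) := c(δ, 2, 1/200)`: a `(2, 1/200)`-layered-good site of a `1/3`-separated configuration is
two-shell good (`IsTwoShellGood (1/20) (47/50) 1`) by the landed
`LayeredWindowsLocal.isTwoShellGood_of_window` (the good site's own chart is a `(2, 1/200)`-window
centred at it), so the non-two-shell-good sites are among the `(2, 1/200)`-bad ones.  With the landed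
necessity `FluxCellKeplerSketchNec.stub_cruxNecessity` this makes those instances of item 13956
NECESSARY for the crux `FluxCellKepler` (`coerciveTwoShellGap_third_of_fluxCellKepler`).  (For
`δ < 1/100` the fixed tolerance `1/200` of the window lemma does not exclude two particles at one
site; the instances `δ < 1/3` are not claimed.)
-/

noncomputable section

open scoped BigOperators Classical

namespace Summit.AtomisticToContinuum.Crystallization.Theorems.FluxCellKeplerSketchGaps

open Summit.AtomisticToContinuum.Crystallization.Theorems.PrestressSplitKorn
open Summit.AtomisticToContinuum.Crystallization.Theorems.HullBridgeExact
open Summit.AtomisticToContinuum.Crystallization.Theorems.LayeredWindowsLocal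
open Literature.MathematicalPhysics.StatisticalMechanics Literature.Geometry.DiscreteGeometry

/-- **The coercive two-shell gap at `δ ≥ 1/3` from the τ-free defect pricing** (registered helper of
line `Sketch`): if the `(R, η)`-layered-bad sites of `δ`-separated finite injective configurations are
priced linearly against `E_LJ − N e*` for every `(δ, R, η)` (the stub `stub_defectPricedExcess`, taken
as hypothesis), then for every `δ ≥ 1/3` some `g > 0` gives `N e* + g · #{¬ two-shell good} ≤ E_LJ(x)`
on every `δ`-separated `x` — take `g := c(δ, 2, 1/200)` and note that a `(2, 1/200)`-layered-good site
is two-shell good (`isTwoShellGood_of_window` with `t = −x i`). [folklore] -/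
theorem coerciveTwoShellGap_third_of_defectPricing : (∀ δ : ℝ, 0 < δ → ∀ R η : ℝ, 0 < R → 0 < η → ∃ c : ℝ, 0 < c ∧ ∀ (N : ℕ) (x : Fin N → EuclideanSpace ℝ (Fin 3)), Function.Injective x → (∀ i j, i ≠ j → δ ≤ dist (x i) (x j)) → c * (Nat.card {i : Fin N // ¬ ∃ a : ℝ, 47 / 50 ≤ a ∧ a ≤ 1 ∧ ∃ (A : EuclideanSpace ℝ (Fin 3) →ₗᵢ[ℝ] EuclideanSpace ℝ (Fin 3)) (s : ℤ → ℤ) (z : ℤ → ℝ), IsHaggSeq s ∧ (∀ m : ℤ, 39 / 50 * a ≤ z (m + 1) - z m ∧ z (m + 1) - z m ≤ 17 / 20 * a) ∧ let S : Set (EuclideanSpace ℝ (Fin 3)) := {p | ∃ m k l : ℤ, p = A (((k : ℝ) • triangularVec₁ a) + ((l : ℝ) • triangularVec₂ a) + ((haggLabel s m : ℝ) • barlowOffset a) + (z m • layerNormal 1))}; (∀ p ∈ S, ‖p‖ ≤ R → ∃ j : Fin N, dist (x j - x i) p ≤ η) ∧ (∀ j : Fin N, ‖x j - x i‖ ≤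 R → ∃ p ∈ S, dist (x j - x i) p ≤ η)} : ℝ) ≤ interactionEnergy lennardJones x - (N : ℝ) * ⨅ Q : PeriodicConfiguration 3, Q.energyPerParticle lennardJones) → ∀ δ : ℝ, 1 / 3 ≤ δ → ∃ g : ℝ, 0 < g ∧ ∀ (N : ℕ) (x : Fin N → EuclideanSpace ℝ (Fin 3)), (∀ i j : Fin N, i ≠ j → δ ≤ dist (x i) (x j)) → (N : ℝ) * (⨅ Q : PeriodicConfiguration 3, Q.energyPerParticle lennardJones) + g * (Nat.card {i : Fin N // ¬ IsTwoShellGood (1 / 20) (47 / 50) 1 x i} : ℝ) ≤ interactionEnergy lennardJones x := by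
  intro h₂ δ hδ
  obtain ⟨c, hc, hcb⟩ := h₂ δ (by linarith) 2 (1 / 200) two_pos (by norm_num)
  refine ⟨c, hc, fun N x hsep => ?_⟩
  have hx : Function.Injective x := by
    intro i j hij
    by_contra hne
    have := hsep i j hne
    rw [hij, dist_self] at this
    linarith
  have hsep3 : ∀ i j : Fin N, i ≠ j → (1 / 3 : ℝ) ≤ dist (x i) (x j) := fun i j hij =>
    hδ.trans (hsep i j hij)
  have key := hcb N x hx hsep
  have hle : Nat.card {i : Fin N // ¬ IsTwoShellGood (1 / 20) (47 / 50) 1 x i} ≤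
      Nat.card {i : Fin N // ¬ ∃ a : ℝ, 47 / 50 ≤ a ∧ a ≤ 1 ∧ ∃ (A : EuclideanSpace ℝ (Fin 3) →ₗᵢ[ℝ] EuclideanSpace ℝ (Fin 3)) (s : ℤ → ℤ) (z : ℤ → ℝ), IsHaggSeq s ∧ (∀ m : ℤ, 39 / 50 * a ≤ z (m + 1) - z m ∧ z (m + 1) - z m ≤ 17 / 20 * a) ∧ let S : Set (EuclideanSpace ℝ (Fin 3)) := {p | ∃ m k l : ℤ, p = A (((k : ℝ) • triangularVec₁ a) + ((l : ℝ) • triangularVec₂ a) + ((haggLabel s m : ℝ) • barlowOffset a) + (z m • layerNormal 1))}; (∀ p ∈ S, ‖p‖ ≤ 2 → ∃ j : Fin N, dist (x j - x i) p ≤ 1 / 200) ∧ (∀ j : Fin N, ‖x j - x i‖ ≤ 2 → ∃ p ∈ S, dist (x j - x i) p ≤ 1 / 200)} := by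
    rw [Nat.card_eq_fintype_card, Nat.card_eq_fintype_card]
    refine Fintype.card_subtype_mono _ _ fun i hi hgood => hi ?_
    obtain ⟨a, ha1, ha2, A, s, z, hs, hz, h12⟩ := hgood
    dsimp only at h12
    rw [nl_setOf_eq_range A a s z] at h12
    obtain ⟨h1, h2⟩ := h12
    have hbox : InBox a z := ⟨ha1, ha2, hz⟩
    refine isTwoShellGood_of_window (A := A) (t := -x i) (R := 2) hsep3 hbox hs ?_ ?_ (by simp)
    · intro p hp hpR
      obtain ⟨j, hj⟩ := h1 p hp hpR
      exact ⟨j, by rwa [← sub_eq_add_neg]⟩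
    · intro j hj
      rw [← sub_eq_add_neg] at hj ⊢
      exact h2 j hj
  have hle' : (Nat.card {i : Fin N // ¬ IsTwoShellGood (1 / 20) (47 / 50) 1 x i} : ℝ) ≤
      (Nat.card {i : Fin N // ¬ ∃ a : ℝ, 47 / 50 ≤ a ∧ a ≤ 1 ∧ ∃ (A : EuclideanSpace ℝ (Fin 3) →ₗᵢ[ℝ] EuclideanSpace ℝ (Fin 3)) (s : ℤ → ℤ) (z : ℤ → ℝ), IsHaggSeq s ∧ (∀ m : ℤ, 39 / 50 * a ≤ z (m + 1) - z m ∧ z (m + 1) - z m ≤ 17 / 20 * a) ∧ let S : Set (EuclideanSpace ℝ (Fin 3)) := {p | ∃ m k l : ℤ, p = A (((k : ℝ) • triangularVec₁ a) + ((l : ℝ) • triangularVec₂ a) + ((haggLabel s m : ℝ) • barlowOffset a) + (z m • layerNormal 1))}; (∀ p ∈ S, ‖p‖ ≤ 2 → ∃ j : Fin N, dist (x j - x i) p ≤ 1 / 200) ∧ (∀ j : Fin N, ‖x j - x i‖ ≤ 2 → ∃ p ∈ S, dist (x j - x i) p ≤ 1 / 200)} : ℝ) := by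
    exact_mod_cast hle
  nlinarith [mul_le_mul_of_nonneg_left hle' hc.le]

/-- **Necessity for the crux**: `FluxCellKepler` implies the instances `δ ≥ 1/3` of
`PhononSlackCertificates.CoerciveTwoShellGap` (item 13956), through the landed necessity
`FluxCellKeplerSketchNec.stub_cruxNecessity` (crux ⇒ τ-free pricing) and
`coerciveTwoShellGap_third_of_defectPricing`. [folklore] -/
theorem coerciveTwoShellGap_third_of_fluxCellKepler
    (hX : Summit.AtomisticToContinuum.Crystallization.Theses.FluxTubeKepler.FluxCellKepler) :
    ∀ δ : ℝ, 1 / 3 ≤ δ → ∃ g : ℝ, 0 < g ∧ ∀ (N : ℕ) (x : Fin N → EuclideanSpace ℝ (Fin 3)), (∀ i j : Fin N, i ≠ j → δ ≤ dist (x i) (x j)) → (N : ℝ) * (⨅ Q : PeriodicConfiguration 3, Q.energyPerParticle lennardJones) + g * (Nat.card {i : Fin N // ¬ IsTwoShellGood (1 / 20) (47 / 50) 1 x i} : ℝ) ≤ interactionEnergy lennardJones x :=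
  coerciveTwoShellGap_third_of_defectPricing
    (Summit.AtomisticToContinuum.Crystallization.Theorems.FluxCellKeplerSketchNec.stub_cruxNecessity hX).2

end Summit.AtomisticToContinuum.Crystallization.Theorems.FluxCellKeplerSketchGaps

end
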